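/-
COR-CM (cell pub-hodgecm2, stage 2 of the Hodge ladder) — Δ2 BRIDGE, X1 (J) pin, piece **(J2) «ALBANESE ON COMPONENTS»**, THE PIN, part A:
the component morphisms `componentInj K h : P_{Γ_K.conj h}(V) ⟶ X_K ⊗_{L,ῑ₁} ℂ` of Liu's compactified Shimura variety `X_K = Sh(𝕍)_K`
(honest datum: Deligne's model `M_K ⊗_c L`, [Liu2021] Prop. C.5) for EVERY index `h ∈ U(V)(𝔸_{L⁺,f})` of the tower
(`HodgeCM/Model/TowerLevel`), with the laws the Δ2 bridge's J-record consumes: (ii) `Rel`-coherence (`transMor γ`), (iii) level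
transitions, (iv) Hecke translates, (v) the legs at representatives form a coproduct cofan of `X_K ⊗ ℂ`.  Part B
(`AlbaneseOnComponents.lean`) puts Liu's Albanese morphism on them.  Seat prover-pub-hodgecm2-d2bridge-prove-5-g0-0 (SEAT ASK OPS-REQUESTS l. 377).
Model cone (`HodgeCM.Model.TowerLevel_1`) + hole-free `CorCM/HComp`, `CorCM/D2Bridge`.  FRAMING: HC_CM is NOT proved; «Δ2 BRIDGE CLOSED» is
NOT claimed; `exists_recordSystem`, `heckeTranslate_definedOver` are cited named facts taken as hypotheses, `hHD ∕ h₃ ∕ hA` the tower's parameters.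
-/
import Summits.HodgeConjecture.CorCM.D2Bridge.ShimuraComponentMaps
import Summits.HodgeConjecture.CorCM.D2Bridge.AlbaneseOnPieceCofan
import Summits.HodgeConjecture.CorCM.B01.Transposition.HComp.HeckeTranslatesOfSec42DataOf
import Summits.HodgeConjecture.CorCM.PortJoin.Universe
import Summits.HodgeConjecture.HodgeCM.Model.TowerLevel_1
import HarnessLib

/-!
# Δ2 bridge, (J2) pin, part A: `componentInj K h : P_{Γ_K.conj h}(V) ⟶ X_K ⊗_{ῑ₁} ℂ` for every tower index `h`

[Liu2021] §4.2 l. 2060–2074, Prop. C.5; [Deligne1979ShimuraVarieties] 2.1.2–2.1.4, 2.2.5; [Milne2005ShimuraVarieties] Lemma 5.13, §13 p. 118.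
Setting: `L : HodgeCM.CMField`, `V : HodgeCM.HermSpace3 L ι₁` (ported codes; `pkgF L = ⟨L.K⟩`, `pkgV V = ⟨V.Hm, …⟩` their tree twins),
`h4 : 4 ≤ [L:ℚ]`, `h : exists_recordSystem`, the record `S = Model.recordOf h (pkgV V) h4` of models `M_K` over `L` along `ι₁`; the PIN
EMBEDDING is any `[Algebra L ℂ]` with `(algebraMap L ℂ) ∘ c = ι₁` (`hι`, i.e. `ῑ₁ = conj ∘ ι₁`), so `X_K ⊗ ℂ = (M_K ⊗_c L) ⊗_{ῑ₁} ℂ ≅ M_K ⊗_{ι₁} ℂ`.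
* §0 `bcObjIsoOfComp` (transitivity of base change typed for `bcFunctor`) and its naturality.
* §1 `levelOf V K` (`.K = K` rfl, `BelowConjThree`, monotone, Hecke-compatible); the pieces `P K h` with their ball data `D`.
* §2 `XK`, `componentInj₀` (into `M_K ⊗_{ι₁} ℂ`, choice over `exists_componentMap`) with its point formula.
* §3 `theta`, `componentInj K h := componentInj₀ ≫ theta⁻¹`, and the LAWS `componentInj_rel`, `componentInj_comp_tr`, `componentInj_comp_map`,
  `componentInj_eq_of_piece`, `exists_isColimit_componentInj`.
Kernel hygiene: unfoldings of `theta`∕`componentInj` are done by `rw` with equation lemmas or by one-step `rfl` lemmas, never by `dsimp`.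
HC_CM is NOT proved; nothing here is a display or a pointer move.
-/

set_option autoImplicit false

noncomputable section

open Function CategoryTheory CategoryTheory.Limits AlgebraicGeometry NumberField Matrix
open scoped Matrix
open Literature.AlgebraicGeometry.Motives Literature.AlgebraicGeometry.HodgeTheory Literature.AlgebraicGeometry.ShimuraVarieties
open Literature.AlgebraicGeometry.ShimuraVarieties.UnitaryCanonicalModel
open Literature.NumberTheory.Automorphic Literature.NumberTheory.Automorphic.UnitaryGroup Literature.NumberTheory.Automorphic.PicardCM
open Literature.NumberTheory.Automorphic.Liu2021 Literature.NumberTheory.Automorphic.Liu2021.AppendixC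
open Literature.NumberTheory.Transcendental (Arapura2012_Cor_15_4_6)
open Literature.Geometry.ComplexHyperbolic
open Literature.Geometry.ComplexHyperbolic.BallModel (Ball)
open Summit.HodgeConjecture.CorCM.Model Summit.HodgeConjecture.CorCM.HComp
open HodgeCM.Model HodgeCM.Model.LevelTranslate HodgeCM.Model.TowerLevel

namespace Summit.HodgeConjecture.CorCM.D2Bridge

open AbelianVariety (bcFunctor)

universe u
/-! ## §0 Transitivity of base change, typed for `bcFunctor`, and its naturality -/

section Theta

variable {k K : Type u} [Field k] [Field K] {M : Type u} [Field M] [Algebra K M] (σ : k →+* K) (ρ : k →+* M)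
  (hc : (algebraMap K M).comp σ = ρ)

/-- `(X ⊗_σ K) ⊗_K M ≅ X ⊗_ρ M` for `algebraMap ∘ σ = ρ` (tree `baseChangeHomObjIsoOfComp`), source typed through `bcFunctor K M`
(= `baseChangeHom (algebraMap K M)` definitionally; the spelling `albOnPiece` uses). [cite: GortzWedhorn2020, Prop. 4.16 and §(4.7)] -/
def bcObjIsoOfComp (X : SchemeOver k) : (bcFunctor K M).obj ((baseChangeHom σ).obj X) ≅ (baseChangeHom ρ).obj X :=
  baseChangeHomObjIsoOfComp σ (algebraMap K M) ρ hc X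

/-- `bcObjIsoOfComp` commutes with the projections to `X`. [cite: GortzWedhorn2020, Prop. 4.16 and §(4.7)] -/
@[reassoc]
theorem bcObjIsoOfComp_hom_left_fst (X : SchemeOver k) :
    (bcObjIsoOfComp σ ρ hc X).hom.left ≫ baseChangeHomFst ρ X =
      baseChangeHomFst (algebraMap K M) ((baseChangeHom σ).obj X) ≫ baseChangeHomFst σ X :=
  baseChangeHomObjIsoOfComp_hom_left_fst σ (algebraMap K M) ρ hc X

/-- **Naturality of `bcObjIsoOfComp` in `X`** (pullback extensionality over the projections). [cite: GortzWedhorn2020, Prop. 4.16 and §(4.7)] -/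
theorem bcObjIsoOfComp_naturality {X Y : SchemeOver k} (m : X ⟶ Y) :
    (bcFunctor K M).map ((baseChangeHom σ).map m) ≫ (bcObjIsoOfComp σ ρ hc Y).hom =
      (bcObjIsoOfComp σ ρ hc X).hom ≫ (baseChangeHom ρ).map m := by
  apply Over.OverMorphism.ext
  apply pullback.hom_ext
  · change ((bcFunctor K M).map ((baseChangeHom σ).map m) ≫ (bcObjIsoOfComp σ ρ hc Y).hom).left ≫ baseChangeHomFst ρ Y =
      ((bcObjIsoOfComp σ ρ hc X).hom ≫ (baseChangeHom ρ).map m).left ≫ baseChangeHomFst ρ Y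
    rw [Over.comp_left, Over.comp_left, Category.assoc, Category.assoc, bcObjIsoOfComp_hom_left_fst,
      baseChangeHom_map_left_comp_fst, bcObjIsoOfComp_hom_left_fst_assoc]
    change ((baseChangeHom (algebraMap K M)).map ((baseChangeHom σ).map m)).left ≫
        baseChangeHomFst (algebraMap K M) ((baseChangeHom σ).obj Y) ≫ baseChangeHomFst σ Y = _
    rw [baseChangeHom_map_left_comp_fst_assoc, baseChangeHom_map_left_comp_fst]
    exact (Category.assoc _ _ _).symm
  · exact (Over.w _).trans (Over.w _).symm

end Theta

/-! ## §1 The tower level of a small `K` and the pieces `P_{Γ_K.conj h}` -/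

section Pin

/-- The tree-side twin of a ported CM-field code (`⟨L.K⟩`, as in `CorCM/D2Bridge/HcmPieces.lean`; `PortJoin.CMField.ofPkg`). [folklore] -/
abbrev pkgF (L : HodgeCM.CMField) : Summit.HodgeConjecture.CorCM.CMField := ⟨L.K⟩
/-- The tree-side twin of a ported hermitian 3-space (`⟨V.Hm, …⟩`; `PortJoin.HermSpace3.ofPkg`). [folklore] -/
abbrev pkgV {L : HodgeCM.CMField} {ι₁ : L →+* ℂ} (V : HodgeCM.HermSpace3 L ι₁) :
    Summit.HodgeConjecture.CorCM.HermSpace3 (pkgF L) ι₁ :=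
  ⟨V.Hm, V.isHermitian, V.signature_ι₁, V.posDef_of_ne⟩

variable {L : HodgeCM.CMField} {ι₁ : L →+* ℂ} (V : HodgeCM.HermSpace3 L ι₁)

/-- **The tower level of a sufficiently small `K`** (`K ≤ K_f(3)`): `(U(V)(L⁺) ∩ K, K)` as a `HodgeCM.Level V` (`HComp.levelOfSmall` through
the port join). [cite: Liu2021, Prop. C.5 l. 4627–4628] -/
def levelOf (K : C5.SmallLevel (K3 (pkgV V))) : HodgeCM.Level V :=
  PortJoin.Level.toPkg (levelOfSmall (pkgV V) K)

/-- (definitional) its compact open is `K`. [cite: Liu2021, Prop. C.5 l. 4627–4628] -/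
@[simp] theorem levelOf_K (K : C5.SmallLevel (K3 (pkgV V))) : (levelOf V K).K = K.1.1 := rfl

/-- A sufficiently small level lies below `K_f(3)` (`BelowConjThree`, the tower's standing hypothesis). [cite: Liu2021, Prop. C.5 l. 4627–4628] -/
theorem belowConjThree_levelOf (K : C5.SmallLevel (K3 (pkgV V))) : (levelOf V K).BelowConjThree :=
  ⟨1, by rw [HodgeCM.Level.conjK_one]; exact K.2⟩

/-- `K ≤ K'` gives `levelOf V K ≤ levelOf V K'`. [cite: Liu2021, Prop. C.5 l. 4627–4628] -/
theorem levelOf_mono {K K' : C5.SmallLevel (K3 (pkgV V))} (hle : K ≤ K') : levelOf V K ≤ levelOf V K' :=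
  HodgeCM.Level.le_def.mpr hle

/-- `4 ≤ [L:ℚ]` puts us in the anisotropic regime of the Picard codes. [folklore] -/
theorem isAnisotropic_of_four_le (h4 : 4 ≤ Module.finrank ℚ L) (Γ : HodgeCM.Level V) :
    (pmsCode L ι₁ V Γ).IsAnisotropic :=
  (isAnisotropic_pmsCode_iff L ι₁ V Γ).2 (isAnisotropic_of_two_lt L ι₁ V Γ (by omega))

variable (hU : BallQuotientUniformisedDatum) (h₃ : CMAbelianVarietyRealised)

/-- The Picard code of the piece of index `h` at the small level `K` (the CONJUGATE level `Γ_K.conj h`). [cite: Deligne1979ShimuraVarieties, §2.1.2] -/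
abbrev code (K : C5.SmallLevel (K3 (pkgV V))) (hh : V.adelicFin) : PicardCode :=
  pmsCode L ι₁ V ((levelOf V K).conj hh (belowConjThree_levelOf V K))

/-- The piece of index `h` at `K`: the tree's surface `P_{Γ_K.conj h}(V)` (the component `Γ_h\𝔹²` of `X_K(ℂ)`). [cite: Deligne1979ShimuraVarieties, §2.1.2] -/
abbrev P (K : C5.SmallLevel (K3 (pkgV V))) (hh : V.adelicFin) : SchemeOver ℂ :=
  Var.scheme hU h₃ (.pms (code V K hh))

/-- The piece is a smooth projective surface. [folklore] -/
theorem isSmoothProjective_P (K : C5.SmallLevel (K3 (pkgV V))) (hh : V.adelicFin) : IsSmoothProjective 2 (P V hU h₃ K hh) :=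
  Var.isSmoothProjective hU h₃ (.pms (code V K hh))

/-- A base point of the piece (Nullstellensatz). [folklore] -/
def basePt (K : C5.SmallLevel (K3 (pkgV V))) (hh : V.adelicFin) : AlgPoints (P V hU h₃ K hh) ℂ :=
  (nonempty_algPoints_pms hU h₃ (code V K hh)).some

variable (h4 : 4 ≤ Module.finrank ℚ L)

/-- Its ball datum (anisotropic regime). [cite: Deligne1979ShimuraVarieties, §2.1.2] -/
abbrev D (K : C5.SmallLevel (K3 (pkgV V))) (hh : V.adelicFin) : UnitaryBallUniformisationDatum 2 (P V hU h₃ K hh) :=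
  Var.ballDatum hU h₃ (code V K hh) (isAnisotropic_of_four_le V h4 ((levelOf V K).conj hh (belowConjThree_levelOf V K)))

/-- The piece's complex Gram matrix is `V.Hm^{ι₁}`. [folklore] -/
theorem D_Hℂ (K : C5.SmallLevel (K3 (pkgV V))) (hh : V.adelicFin) : (D V hU h₃ h4 K hh).Hℂ = V.Hm.map ι₁ :=
  ballDatum_Hℂ hU h₃ ((levelOf V K).conj hh (belowConjThree_levelOf V K))
    (isAnisotropic_of_four_le V h4 ((levelOf V K).conj hh (belowConjThree_levelOf V K)))

/-- The piece's group, read in `GL₃(ℂ)`, is the natural level `Γ_H(hKh⁻¹)^{ι₁}`. [cite: Deligne1979ShimuraVarieties, §2.1.2] -/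
theorem D_map_Γ (K : C5.SmallLevel (K3 (pkgV V))) (hh : V.adelicFin) :
    (D V hU h₃ h4 K hh).Γ.map (Matrix.GeneralLinearGroup.map (D V hU h₃ h4 K hh).τ₁) =
      (arithmeticLevel (↥(maximalRealSubfield L)) L (IsCMField.complexConj L) 3 V.Hm
        ((K.1.1 : Subgroup V.adelicFin).map (MulAut.conj hh).toMonoidHom)).map (Matrix.GeneralLinearGroup.map ι₁) :=
  ballDatum_map_Γ hU h₃ ((levelOf V K).conj hh (belowConjThree_levelOf V K))
    (isAnisotropic_of_four_le V h4 ((levelOf V K).conj hh (belowConjThree_levelOf V K)))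

/-- The Hecke step's level condition `hK₁h⁻¹ ⊆ (hg)K(hg)⁻¹` (`g⁻¹K₁g ⊆ K`) as `TransCond 1`. [cite: Milne2005ShimuraVarieties, §13 p. 118 L21–26] -/
theorem transCond_conj_mul_of_heckeLE {K₁ K : C5.SmallLevel (K3 (pkgV V))} {g : V.adelicFin} (hle : C5.HeckeLE g K₁ K)
    (hh : V.adelicFin) :
    TransCond ((1 : ↥(Urat V)) : GL (Fin 3) L) ((levelOf V K₁).conj hh (belowConjThree_levelOf V K₁))
      ((levelOf V K).conj (hh * g) (belowConjThree_levelOf V K)) := by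
  refine TransCond.one_of_le (HodgeCM.Level.Γ_mono (HodgeCM.Level.le_def.mpr ?_))
  intro x hx
  obtain ⟨k, hk, rfl⟩ := HodgeCM.Level.mem_conjK_iff.mp hx
  exact HodgeCM.Level.mem_conjK_iff.mpr ⟨g⁻¹ * k * g, hle k hk, by group⟩

/-- `g⁻¹K₁g ⊆ K` gives `levelOf V K₁ ≤ (levelOf V K).conj g` (the `Γof_hecke` clause of `ComponentAlbanese`). [cite: Milne2005ShimuraVarieties, §13 p. 118 L21–26] -/
theorem levelOf_le_conj_of_heckeLE {K₁ K : C5.SmallLevel (K3 (pkgV V))} {g : V.adelicFin} (hle : C5.HeckeLE g K₁ K) :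
    levelOf V K₁ ≤ (levelOf V K).conj g (belowConjThree_levelOf V K) := by
  refine HodgeCM.Level.le_def.mpr fun x hx => ?_
  exact HodgeCM.Level.mem_conjK_iff.mpr ⟨g⁻¹ * x * g, hle x hx, by group⟩

/-! ## §2 The record, `X_K`, and the component morphisms into `M_K ⊗_{ι₁} ℂ` -/

variable (h : exists_recordSystem)

/-- Liu's `X_K = Sh(𝕍)_K` of the honest datum, `M_K ⊗_{L,c} L` (definitionally the `X_K` of `Model.compactifiedOf` and of every
`Sec42Data.ofAlbanese … (compactifiedOf …) alb`). [cite: Liu2021, §4.2 l. 2062 and Prop. C.5] -/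
abbrev XK (K : C5.SmallLevel (K3 (pkgV V))) : SchemeOver (pkgF L) :=
  (baseChangeHom (cmConjRingHom L)).obj ((recordFunctorOf h (pkgV V)).obj K)

variable (hHD : exists_isReal_hodgeModel)

/-- The component morphism INTO `M_K ⊗_{ι₁} ℂ` (choice over `exists_componentMap`). [cite: Deligne1979ShimuraVarieties, §2.1.2] -/
def componentInj₀ (K : C5.SmallLevel (K3 (pkgV V))) (hh : V.adelicFin) :
    P V hU h₃ K hh ⟶ (baseChangeHom ι₁).obj ((recordOf h (pkgV V) h4).M.obj K) :=
  (exists_componentMap (recordOf h (pkgV V) h4) K hh (D V hU h₃ h4 K hh)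
    ⟨BettiUniverse.realHodgeModel hHD (isSmoothProjective_P V hU h₃ K hh)⟩ (D_Hℂ V hU h₃ h4 K hh)
    (D_map_Γ V hU h₃ h4 K hh)).choose

/-- Its point formula: `componentInj₀ K h [T·lift x] = [x, hK]`. [cite: Deligne1979ShimuraVarieties, §2.1.2] [cite: Milne2005ShimuraVarieties, Lemma 5.13 p. 57] -/
theorem componentInj₀_spec (K : C5.SmallLevel (K3 (pkgV V))) (hh : V.adelicFin) (x : Ball) :
    AlgPoints.map (componentInj₀ V hU h₃ h4 h hHD K hh)
        ((D V hU h₃ h4 K hh).unif ((frameOf (pkgV V) : Matrix (Fin 3) (Fin 3) ℂ) *ᵥ BallModel.lift x)) =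
      AlgPoints.baseChangeEquiv ι₁ ((recordOf h (pkgV V) h4).M.obj K)
        (((recordOf h (pkgV V) h4).pts K).symm (ShimuraSet.mk _ _ _ _ _ K.1.1 x hh)) :=
  (exists_componentMap (recordOf h (pkgV V) h4) K hh (D V hU h₃ h4 K hh)
    ⟨BettiUniverse.realHodgeModel hHD (isSmoothProjective_P V hU h₃ K hh)⟩ (D_Hℂ V hU h₃ h4 K hh)
    (D_map_Γ V hU h₃ h4 K hh)).choose_spec x

/-! ## §3 `X_K ⊗_{ῑ₁} ℂ ≅ M_K ⊗_{ι₁} ℂ` and the component morphisms `componentInj K h : P_{Γ_K.conj h} ⟶ X_K ⊗ ℂ` -/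

variable [Algebra L ℂ] (hι : (algebraMap L ℂ).comp (cmConjRingHom L) = ι₁)

/-- **`X_K ⊗_{ῑ₁} ℂ ≅ M_K ⊗_{ι₁} ℂ`** (`ῑ₁ ∘ c = ι₁`): `recordFunctorOf_objIso` base-changed, then `bcObjIsoOfComp`. [cite: Liu2021, Prop. C.5 l. 4627–4633] [cite: GortzWedhorn2020, Prop. 4.16] -/
def theta (K : C5.SmallLevel (K3 (pkgV V))) :
    (bcFunctor L ℂ).obj (XK V h K) ≅ (baseChangeHom ι₁).obj ((recordOf h (pkgV V) h4).M.obj K) :=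
  (bcFunctor L ℂ).mapIso ((baseChangeHom (cmConjRingHom L)).mapIso (recordFunctorOf_objIso h (pkgV V) h4 K)) ≪≫
    bcObjIsoOfComp (cmConjRingHom L) ι₁ hι ((recordOf h (pkgV V) h4).M.obj K)

/-- `(F.mapIso (G.mapIso A)).hom = F.map (G.map A.hom)` at the record functor's identification (`rfl`; kept as a separate lemma because the
kernel checks these unfoldings cheaply one at a time, not composed). [folklore] -/
theorem mapIso_objIso_hom (K : C5.SmallLevel (K3 (pkgV V))) :
    ((bcFunctor L ℂ).mapIso ((baseChangeHom (cmConjRingHom L)).mapIso (recordFunctorOf_objIso h (pkgV V) h4 K))).hom =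
      (bcFunctor L ℂ).map ((baseChangeHom (cmConjRingHom L)).map (recordFunctorOf_objIso h (pkgV V) h4 K).hom) := rfl

/-- `theta.hom` is the composite `(F.mapIso (G.mapIso A)).hom ≫ Θ.hom` (`rfl` on `Iso.trans`). [folklore] -/
theorem theta_hom' (K : C5.SmallLevel (K3 (pkgV V))) :
    (theta V h4 h hι K).hom =
      ((bcFunctor L ℂ).mapIso ((baseChangeHom (cmConjRingHom L)).mapIso (recordFunctorOf_objIso h (pkgV V) h4 K))).hom ≫
        (bcObjIsoOfComp (cmConjRingHom L) ι₁ hι ((recordOf h (pkgV V) h4).M.obj K)).hom := rfl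

/-- Unfolding `theta.hom`: `F.map (G.map A.hom) ≫ Θ.hom`. [folklore] -/
theorem theta_hom (K : C5.SmallLevel (K3 (pkgV V))) :
    (theta V h4 h hι K).hom =
      (bcFunctor L ℂ).map ((baseChangeHom (cmConjRingHom L)).map (recordFunctorOf_objIso h (pkgV V) h4 K).hom) ≫
        (bcObjIsoOfComp (cmConjRingHom L) ι₁ hι ((recordOf h (pkgV V) h4).M.obj K)).hom :=
  (theta_hom' V h4 h hι K).trans (congrArg (· ≫ (bcObjIsoOfComp (cmConjRingHom L) ι₁ hι ((recordOf h (pkgV V) h4).M.obj K)).hom)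
    (mapIso_objIso_hom V h4 h K))

set_option maxHeartbeats 4000000 in
/-- **Naturality of `theta`** along a morphism of models `m : M_K ⟶ M_{K'}` read on the `X_K`. [cite: GortzWedhorn2020, Prop. 4.16] -/
theorem theta_naturality {K K' : C5.SmallLevel (K3 (pkgV V))}
    (m : (recordOf h (pkgV V) h4).M.obj K ⟶ (recordOf h (pkgV V) h4).M.obj K') :
    (bcFunctor L ℂ).map ((baseChangeHom (cmConjRingHom L)).map
        ((recordFunctorOf_objIso h (pkgV V) h4 K).hom ≫ m ≫ (recordFunctorOf_objIso h (pkgV V) h4 K').inv)) ≫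
        (theta V h4 h hι K').hom =
      (theta V h4 h hι K).hom ≫ (baseChangeHom ι₁).map m := by
  have e1 : ((recordFunctorOf_objIso h (pkgV V) h4 K).hom ≫ m ≫ (recordFunctorOf_objIso h (pkgV V) h4 K').inv) ≫
      (recordFunctorOf_objIso h (pkgV V) h4 K').hom = (recordFunctorOf_objIso h (pkgV V) h4 K).hom ≫ m := by
    rw [Category.assoc, Category.assoc, Iso.inv_hom_id, Category.comp_id]
  rw [theta_hom, theta_hom, Category.assoc, ← Functor.map_comp_assoc, ← Functor.map_comp, e1, Functor.map_comp,
    Functor.map_comp_assoc, bcObjIsoOfComp_naturality (cmConjRingHom L) ι₁ hι m]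

/-- **The component morphism `P_{Γ_K.conj h}(V) ⟶ X_K ⊗_{ῑ₁} ℂ` of index `h`** — the piece `Γ_h\𝔹² ↪ X_K(ℂ)`, `[z] ↦ [z, hK]`
([Deligne1979ShimuraVarieties] 2.1.2), for EVERY `h`. [cite: Deligne1979ShimuraVarieties, §2.1.2] [cite: Liu2021, §4.2 l. 2062 and Prop. C.5] -/
def componentInj (K : C5.SmallLevel (K3 (pkgV V))) (hh : V.adelicFin) : P V hU h₃ K hh ⟶ (bcFunctor L ℂ).obj (XK V h K) :=
  componentInj₀ V hU h₃ h4 h hHD K hh ≫ (theta V h4 h hι K).inv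

set_option maxHeartbeats 4000000 in
/-- **LAW (ii) — `Rel`-coherence ON THE NOSE**: for `TowerLevel.Rel Γ_K γ h h'`, `componentInj K h = transMor γ ≫ componentInj K h'`
(the two indices name the same component, identified by `z ↦ γz`). [cite: Deligne1979ShimuraVarieties, §2.1.2] [cite: Milne2005ShimuraVarieties, Lemma 5.13 p. 57 and Prop. 13.1 p. 117] -/
theorem componentInj_rel (hA : Arapura2012_Cor_15_4_6) (K : C5.SmallLevel (K3 (pkgV V))) {hh hh' : V.adelicFin} {γ : ↥(Urat V)}
    (r : Rel (levelOf V K) γ hh hh') :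
    componentInj V hU h₃ h4 h hHD hι K hh =
      transMor hU h₃ hHD hA γ.2 ((levelOf V K).conj hh (belowConjThree_levelOf V K))
          ((levelOf V K).conj hh' (belowConjThree_levelOf V K)) (transCond_of_rel (belowConjThree_levelOf V K) r) ≫
        componentInj V hU h₃ h4 h hHD hι K hh' := by
  have key := componentMap_eq_comp_of_rel (recordOf h (pkgV V) h4) K γ r (D V hU h₃ h4 K hh) (D V hU h₃ h4 K hh')
    (D_Hℂ V hU h₃ h4 K hh) (D_Hℂ V hU h₃ h4 K hh')
    (transMor hU h₃ hHD hA γ.2 ((levelOf V K).conj hh (belowConjThree_levelOf V K))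
      ((levelOf V K).conj hh' (belowConjThree_levelOf V K)) (transCond_of_rel (belowConjThree_levelOf V K) r))
    (fun v hv => map_transMor_unif hU h₃ hHD hA γ.2 _ (isAnisotropic_of_two_lt L ι₁ V (levelOf V K) (by omega)) hv)
    (componentInj₀ V hU h₃ h4 h hHD K hh) (componentInj₀ V hU h₃ h4 h hHD K hh')
    (componentInj₀_spec V hU h₃ h4 h hHD K hh) (componentInj₀_spec V hU h₃ h4 h hHD K hh')
  rw [componentInj, componentInj, key, Category.assoc]

set_option maxHeartbeats 4000000 in
/-- **LAW (iv) — Hecke translates ON THE NOSE** (`Model.sec42DataOfFourLe_heckeTranslates`, [Milne2005ShimuraVarieties] Thm. 13.6 via `hU7`;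
`g⁻¹K₁g ⊆ K`): `componentInj K₁ h ≫ (T_g)_ℂ = transMor 1 ≫ componentInj K (hg)` («`T(g) : [x, aK] ↦ [x, agK′]`»). [cite: Milne2005ShimuraVarieties, §13 p. 118 L21–26 and Thm. 13.6] [cite: Liu2021, §4.2 l. 2074] -/
theorem componentInj_comp_tr (hA : Arapura2012_Cor_15_4_6) (hU7 : heckeTranslate_definedOver) (Φ : CMType (pkgF L)) (iso : ℕ → Prop)
    {K₁ K : C5.SmallLevel (K3 (pkgV V))} (g : V.adelicFin) (hle : C5.HeckeLE g K₁ K) (hh : V.adelicFin) :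
    (componentInj V hU h₃ h4 h hHD hι K₁ hh ≫
        (bcFunctor L ℂ).map ((sec42DataOfFourLe_heckeTranslates hU7 h (pkgV V) Φ h4 iso).tr g K₁ K hle) :
        P V hU h₃ K₁ hh ⟶ (bcFunctor L ℂ).obj (XK V h K)) =
      transMor hU h₃ hHD hA (Subgroup.one_mem (Urat V)) ((levelOf V K₁).conj hh (belowConjThree_levelOf V K₁))
          ((levelOf V K).conj (hh * g) (belowConjThree_levelOf V K)) (transCond_conj_mul_of_heckeLE V hle hh) ≫
        componentInj V hU h₃ h4 h hHD hι K (hh * g) := by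
  have key := componentMap_comp_heckeTranslate (recordOf h (pkgV V) h4) g hh
    (isHeckeTranslate_recordHeckeTranslate hU7 h (pkgV V) h4 g K₁ K hle) (D V hU h₃ h4 K₁ hh) (D V hU h₃ h4 K (hh * g))
    (D_Hℂ V hU h₃ h4 K₁ hh)
    (transMor hU h₃ hHD hA (Subgroup.one_mem (Urat V)) ((levelOf V K₁).conj hh (belowConjThree_levelOf V K₁))
      ((levelOf V K).conj (hh * g) (belowConjThree_levelOf V K)) (transCond_conj_mul_of_heckeLE V hle hh))
    (fun v hv => by
      rw [map_transMor_unif hU h₃ hHD hA _ _ (isAnisotropic_of_two_lt L ι₁ V (levelOf V K) (by omega)) hv]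
      simp only [glι, map_one, Units.val_one, one_mulVec])
    (componentInj₀ V hU h₃ h4 h hHD K₁ hh) (componentInj₀ V hU h₃ h4 h hHD K (hh * g))
    (componentInj₀_spec V hU h₃ h4 h hHD K₁ hh) (componentInj₀_spec V hU h₃ h4 h hHD K (hh * g))
  have htr : (sec42DataOfFourLe_heckeTranslates hU7 h (pkgV V) Φ h4 iso).tr g K₁ K hle =
      (baseChangeHom (cmConjRingHom L)).map ((recordFunctorOf_objIso h (pkgV V) h4 K₁).hom ≫
        recordHeckeTranslate hU7 h (pkgV V) h4 g K₁ K hle ≫ (recordFunctorOf_objIso h (pkgV V) h4 K).inv) := rfl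
  have key' := congrArg (· ≫ (theta V h4 h hι K).inv) key
  simp only [Category.assoc] at key'
  rw [componentInj, componentInj]
  simp only [Category.assoc]
  convert key' using 2
  rw [Iso.inv_comp_eq, ← Category.assoc, Iso.eq_comp_inv, htr]
  exact theta_naturality V h4 h hι (recordHeckeTranslate hU7 h (pkgV V) h4 g K₁ K hle)

set_option maxHeartbeats 4000000 in
/-- **LAW (iii) — level transitions ON THE NOSE** (`K ≤ K'`, `u : X_K ⟶ X_{K'}`, `[z, aK] ↦ [z, aK']`):
`componentInj K h ≫ u_ℂ = transMor 1 ≫ componentInj K' h`. [cite: Deligne1979ShimuraVarieties, 2.1.4] [cite: Liu2021, §4.2 l. 2062–2064] -/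
theorem componentInj_comp_map (hA : Arapura2012_Cor_15_4_6) (Φ : CMType (pkgF L)) {K K' : C5.SmallLevel (K3 (pkgV V))} (f : K ⟶ K')
    (hh : V.adelicFin) :
    (componentInj V hU h₃ h4 h hHD hι K hh ≫ (bcFunctor L ℂ).map ((compactifiedOf h (pkgV V) Φ h4).X.map f) :
        P V hU h₃ K hh ⟶ (bcFunctor L ℂ).obj (XK V h K')) =
      transMor hU h₃ hHD hA (Subgroup.one_mem (Urat V)) ((levelOf V K).conj hh (belowConjThree_levelOf V K))
          ((levelOf V K').conj hh (belowConjThree_levelOf V K'))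
          (transCond_conj_of_le (levelOf_mono V f.le) (belowConjThree_levelOf V K') (belowConjThree_levelOf V K) hh) ≫
        componentInj V hU h₃ h4 h hHD hι K' hh := by
  have key := componentMap_comp_map (recordOf h (pkgV V) h4) f hh (D V hU h₃ h4 K hh) (D V hU h₃ h4 K' hh)
    (D_Hℂ V hU h₃ h4 K hh)
    (transMor hU h₃ hHD hA (Subgroup.one_mem (Urat V)) ((levelOf V K).conj hh (belowConjThree_levelOf V K))
      ((levelOf V K').conj hh (belowConjThree_levelOf V K'))
      (transCond_conj_of_le (levelOf_mono V f.le) (belowConjThree_levelOf V K') (belowConjThree_levelOf V K) hh))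
    (fun v hv => by
      rw [map_transMor_unif hU h₃ hHD hA _ _ (isAnisotropic_of_two_lt L ι₁ V (levelOf V K) (by omega)) hv]
      simp only [glι, map_one, Units.val_one, one_mulVec])
    (componentInj₀ V hU h₃ h4 h hHD K hh) (componentInj₀ V hU h₃ h4 h hHD K' hh)
    (componentInj₀_spec V hU h₃ h4 h hHD K hh) (componentInj₀_spec V hU h₃ h4 h hHD K' hh)
  have hmap' : (recordFunctorOf h (pkgV V)).map f = (recordFunctorOf_objIso h (pkgV V) h4 K).hom ≫
      (recordOf h (pkgV V) h4).M.map f ≫ (recordFunctorOf_objIso h (pkgV V) h4 K').inv := by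
    rw [← Category.assoc, Iso.eq_comp_inv]
    exact (recordFunctorOfIso h (pkgV V) h4).hom.naturality f
  have hsq := theta_naturality V h4 h hι ((recordOf h (pkgV V) h4).M.map f)
  rw [← hmap'] at hsq
  have key' := congrArg (· ≫ (theta V h4 h hι K').inv) key
  simp only [Category.assoc] at key'
  rw [componentInj, componentInj]
  simp only [Category.assoc]
  convert key' using 2
  rw [Iso.inv_comp_eq, ← Category.assoc, Iso.eq_comp_inv]
  exact hsq

set_option maxHeartbeats 4000000 in
/-- A ball-quotient piece `X'` mapping into `M_K ⊗_{ι₁} ℂ` by `[T·lift x] ↦ [x, g K]` IS the component of index `g` up to the model-match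
isomorphism `e : X' ≅ P_{Γ_K.conj g}` over the uniformisations: `componentInj K g = e⁻¹ ≫ ι' ≫ theta⁻¹`. [cite: Deligne1979ShimuraVarieties, §2.1.2] [cite: Mumford1981, §4B (4.15) Corollary, p. 67] -/
theorem componentInj_eq_of_piece (K : C5.SmallLevel (K3 (pkgV V))) (g : V.adelicFin) {X' : SchemeOver ℂ}
    (B' : UnitaryBallUniformisationDatum 2 X') (hB' : B'.Hℂ = V.Hm.map ι₁)
    (ι' : X' ⟶ (baseChangeHom ι₁).obj ((recordOf h (pkgV V) h4).M.obj K))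
    (hι' : ∀ x : Ball, AlgPoints.map ι' (B'.unif ((frameOf (pkgV V) : Matrix (Fin 3) (Fin 3) ℂ) *ᵥ BallModel.lift x)) =
      AlgPoints.baseChangeEquiv ι₁ ((recordOf h (pkgV V) h4).M.obj K)
        (((recordOf h (pkgV V) h4).pts K).symm (ShimuraSet.mk _ _ _ _ _ K.1.1 x g)))
    (e : X' ≅ P V hU h₃ K g) (he : ∀ v ∈ B'.cone, AlgPoints.map e.hom (B'.unif v) = (D V hU h₃ h4 K g).unif v) :
    componentInj V hU h₃ h4 h hHD hι K g = e.inv ≫ ι' ≫ (theta V h4 h hι K).inv := by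
  have hq : e.hom ≫ componentInj₀ V hU h₃ h4 h hHD K g = ι' := by
    haveI := isSeparated_baseChange_record (recordOf h (pkgV V) h4) K
    refine hom_ext_of_frame (formCongr_frameOf (pkgV V)) B' hB' fun x => ?_
    have hcone : (frameOf (pkgV V) : Matrix (Fin 3) (Fin 3) ℂ) *ᵥ BallModel.lift x ∈ B'.cone := by
      change _ ∈ negCone B'.Hℂ
      rw [hB']
      exact frame_mulVec_lift_mem_negCone (formCongr_frameOf (pkgV V)) x
    rw [AlgPoints.map_comp_apply, he _ hcone, componentInj₀_spec, hι' x]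
  rw [Iso.eq_inv_comp, componentInj, ← Category.assoc, hq]

set_option maxHeartbeats 4000000 in
/-- **LAW (v) — the components at the record's representatives `g_q` of `Ξ_K` form a coproduct cofan of `X_K ⊗_{ῑ₁} ℂ`** («`M_ℂ` is the
disjoint sum of the `Γ_g\X⁺`»; the record's `pieces` cofan, pieces identified by `UnitaryBallModelUnique.exists_iso_of_eq`, legs compared by
`componentInj_eq_of_piece`). [cite: Deligne1979ShimuraVarieties, §2.1.2] [cite: Mumford1981, §4B (4.15) Corollary, p. 67] -/
theorem exists_isColimit_componentInj (K : C5.SmallLevel (K3 (pkgV V))) :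
    ∃ (Ξ : Type) (_ : Finite Ξ) (g : Ξ → V.adelicFin),
      Nonempty (IsColimit (Cofan.mk ((bcFunctor L ℂ).obj (XK V h K)) (fun q => componentInj V hU h₃ h4 h hHD hι K (g q)))) := by
  classical
  obtain ⟨g, -, X, ι, hcol, B, hB⟩ := (recordOf h (pkgV V) h4).pieces K
  haveI := Summit.HodgeConjecture.CorCM.Model.finite_shimuraIndex (pkgV V) h4 (K.1.1 : Subgroup V.adelicFin) K.1.2.1
  refine ⟨_, inferInstance, g, ?_⟩
  -- each record piece IS the tree surface of its index, over the uniformisations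
  have hiso : ∀ q, ∃ e : X q ≅ P V hU h₃ K (g q),
      ∀ v ∈ (B q).cone, AlgPoints.map e.hom ((B q).unif v) = (D V hU h₃ h4 K (g q)).unif v := by
    intro q
    obtain ⟨hH1, hΓ1, -⟩ := hB q
    have hH2 : (B q).Hℂ = (D V hU h₃ h4 K (g q)).Hℂ := by rw [hH1, D_Hℂ]
    have hΓ2 : (B q).Γ.map (Matrix.GeneralLinearGroup.map (B q).τ₁) =
        (D V hU h₃ h4 K (g q)).Γ.map (Matrix.GeneralLinearGroup.map (D V hU h₃ h4 K (g q)).τ₁) := by rw [hΓ1, D_map_Γ]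
    obtain ⟨e, he, -⟩ := UnitaryBallModelUnique.exists_iso_of_eq_of_nonempty
      (X₁ := X q) (X₂ := P V hU h₃ K (g q)) (D₁ := B q) (D₂ := D V hU h₃ h4 K (g q))
      (let ⟨A, _⟩ := exists_isReal_hodgeModel_holds 2 (X q) (B q).isSmoothProjective; ⟨A⟩)
      ⟨BettiUniverse.realHodgeModel hHD (isSmoothProjective_P V hU h₃ K (g q))⟩ hH2 hΓ2
    exact ⟨e, he⟩
  choose e he using hiso
  have hleg : ∀ q, componentInj V hU h₃ h4 h hHD hι K (g q) = (e q).inv ≫ ι q ≫ (theta V h4 h hι K).inv := fun q =>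
    componentInj_eq_of_piece V hU h₃ h4 h hHD hι K (g q) (B q) (hB q).1 (ι q) (hB q).2.2 (e q) (he q)
  have hfun : (fun q => componentInj V hU h₃ h4 h hHD hι K (g q)) = fun q => (e q).symm.hom ≫ (ι q ≫ (theta V h4 h hι K).inv) :=
    funext fun q => by rw [hleg q, Iso.symm_hom]
  rw [hfun]
  exact nonempty_isColimit_cofan_of_iso (fun q => ι q ≫ (theta V h4 h hι K).inv)
    (hcol.ofIsoColimit (Cofan.ext (theta V h4 h hι K).symm (fun _ => rfl))) (fun q => (e q).symm)

end Pin

end Summit.HodgeConjecture.CorCM.D2Bridge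

end
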